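import Mathlib
import Literature.Computability.AlgebraicComplexity.NestFreeMatchingPoly
import Literature.Computability.AlgebraicComplexity.HomogeneousComponentsComplexity
import Literature.Computability.AlgebraicComplexity.ChowSymmetric
import Summits.ValiantsHypothesis.ValiantsHypothesis.Theses.FifoMatching
import HarnessLib

/-!
# R2 ⇒ R2ᵒ — the ORDER upgrade of the quasi-polynomial-degree cofactor rung, and the residual picture
# R2 + N2♯ ⇒ `NNDivisionHard`, BY NAME against the route items `Theses.FifoMatching.NNQuasiPolyLogDegreeCofactorHard`
# (stmt-ValiantsHypothesis-27271), `…NNLinearDegreeCofactorHard` (stmt-23918), `…NNDivisionHard` (stmt-21181)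

Port to `Theorems/` (director-valiant g12 R192 (e) / R193 (b), val-lit desk: val-port-2 lineage = S-port hand, file F7)
of § «ORDER upgrade (rev 7, PROVED)» and of the division-side spine of val-idea-7 g7's kernel-checked line workfile
`Cruxes/NNLinearDegreeCofactorHard/Lines/shadow_division.lean` rev 7 @4c8bb64b4acf, verbatim bodies, with NO
definitions (crit-3 #21b port note (a)): the rung R2 is the route decl BY NAME, the line-local statements R2ᵒ
(`NNQuasiPolyLogOrderCofactorHard`), N2 (`NNCofactorDegreeReduction`), N2♯ (`NNCofactorOrderReduction`), N3
(`NNMultiplesHard`) and the threshold `T c n = 2^((log₂ n + c)^c)` are UNFOLDED over the library polynomial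
`nestFreeMatchingPoly n ℝ≥0` (definitionally the route's inlined `NN_n`), and the two closed/residual route items
23918 / 21181 are concluded BY NAME.

* `homogeneousComponent_nn_mul` — `(NN_n · h)^{(n+d)} = NN_n · h^{(d)}` (`NN_n` homogeneous of degree `n`,
  `nestFreeMatchingPoly_isHomogeneous`; `weightedHomogeneousComponent_mul_left` [Chow]).
* `order_bookkeeping` — `(n + d + 2)² · T c n ≤ T (c+k+2) n` for `n ≥ 2⁹`, `d ≤ 2^((log₂ n + k)^k)`.
* ★ `orderRung_of_rung` — **R2 ⇒ R2ᵒ**: the DEGREE hypothesis of the rung relaxes to an ORDER hypothesis — `NN_n · h`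
  is hard for every cofactor `h` having SOME nonzero homogeneous component `h^{(d)}` of quasi-polynomial degree `d`,
  whatever the total degree of `h`: apply R2 to `h^{(d)}`, then
  `L₊(NN_n · h^{(d)}) = L₊((NN_n·h)^{(n+d)}) ≤ (n+d+2)² · L₊(NN_n·h)` [BCS Lemma 21.25 =
  `complexity_homogeneousComponent_le_sq_mul`, any commutative semiring, so `ℝ≥0`].
* `constantTerm_cofactor_hard` — corollary: every cofactor with a nonzero CONSTANT TERM, of any degree.
* `linearDegree_of_rung` — ladder sanity, BY NAME: R2 ⇒ the CLOSED item 23918 `NNLinearDegreeCofactorHard` (`a = 1`).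
* `exponent_bookkeeping`, `exists_homogeneousComponent_ne_zero`, `orderReduction_of_reduction` (N2 ⇒ N2♯),
  `multiples_of_orderRung_of_orderReduction` (R2ᵒ + N2♯ ⇒ N3) — the division-side logic (NN twin of the kernel-checked
  `DivisionGap.ShadowCofactorSplit`), and ★ `nnDivisionHard_of_rung_of_orderReduction` /
  `nnDivisionHard_of_rung_of_reduction` — THE RESIDUAL PICTURE BY NAME: R2 (stmt-27271) + N2♯ (resp. N2) ⇒ stmt-21181
  `NNDivisionHard`.  What N2♯ leaves genuinely open = cofactors supported ENTIRELY in super-quasi-polynomial degrees.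

HONEST FRAMING: implications between OPEN statements — R2 = stmt-27271 is OPEN (its line inputs A1 and G♭ = stmt-27045
are OPEN), N2 / N2♯ are law-side residuals NOT filed as items (director R165 (b) / R192 (e)), stmt-21181 stays OPEN;
no rung of record moves; nothing here bears on `VP ≠ VNP`, which is NOT proved.

References: P. Bürgisser, M. Clausen, M. A. Shokrollahi, *Algebraic Complexity Theory* (1997), Lemma (21.25)
[BurgisserClausenShokrollahi1997]; P. Hrubeš, A. Yehudayoff, *Shadows of Newton polytopes*, CCC 2021, Prop 43(2)/Rem 20
[HrubesYehudayoff2021].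
-/

set_option autoImplicit false

-- the mandated summit-side namespace repeats a component by design (single-problem summit)
set_option linter.dupNamespace false

noncomputable section

namespace Summit.ValiantsHypothesis.ValiantsHypothesis.Theorems.FifoMatching

namespace NNOrderRung

open scoped NNReal
open MvPolynomial
open Literature.Computability.AlgebraicComplexity

/-! ## The order upgrade R2 ⇒ R2ᵒ -/

/-- `(NN_n · h)^{(n+d)} = NN_n · h^{(d)}`: `NN_n` is homogeneous of degree `n`. -/
theorem homogeneousComponent_nn_mul (n d : ℕ) (h : MvPolynomial (Fin (2 * n) × Fin (2 * n)) ℝ≥0) :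
    homogeneousComponent (n + d) (nestFreeMatchingPoly n ℝ≥0 * h) =
      nestFreeMatchingPoly n ℝ≥0 * homogeneousComponent d h :=
  weightedHomogeneousComponent_mul_left (nestFreeMatchingPoly_isHomogeneous n) h d

/-- exponent bookkeeping for the order upgrade: `(n + d + 2)² · 2^((log₂ n + c)^c) ≤ 2^((log₂ n + (c+k+2))^(c+k+2))`
once `n ≥ 2⁹` and `d ≤ 2^((log₂ n + k)^k)`. -/
theorem order_bookkeeping (k c n d : ℕ) (hn : 2 ^ 9 ≤ n) (hd : d ≤ 2 ^ ((Nat.log 2 n + k) ^ k)) :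
    (n + d + 2) ^ 2 * 2 ^ ((Nat.log 2 n + c) ^ c) ≤ 2 ^ ((Nat.log 2 n + (c + k + 2)) ^ (c + k + 2)) := by
  set L := Nat.log 2 n with hL
  have hL9 : 9 ≤ L := by
    rw [hL]; exact Nat.le_log_of_pow_le (by norm_num) hn
  set E := (L + k) ^ k + L + 1 with hE
  have hnlt : n < 2 ^ (L + 1) := Nat.lt_pow_succ_log_self (by norm_num) n
  have h2E : 2 ^ (L + 1) ≤ 2 ^ E := Nat.pow_le_pow_right (by norm_num) (by omega)
  have hdE : 2 ^ ((L + k) ^ k) ≤ 2 ^ E := Nat.pow_le_pow_right (by norm_num) (by omega)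
  have h1E : 2 ≤ 2 ^ E := by
    calc (2:ℕ) = 2 ^ 1 := by norm_num
      _ ≤ 2 ^ E := Nat.pow_le_pow_right (by norm_num) (by omega)
  have hsum : n + d + 2 ≤ 4 * 2 ^ E := by omega
  have hsq : (n + d + 2) ^ 2 ≤ 2 ^ (2 * E + 4) := by
    calc (n + d + 2) ^ 2 ≤ (4 * 2 ^ E) ^ 2 := Nat.pow_le_pow_left hsum 2
      _ = 2 ^ (2 * E + 4) := by
        rw [mul_pow, ← pow_mul, show (4:ℕ) ^ 2 = 2 ^ 4 by norm_num, ← pow_add]; ring_nf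
  set A := L + c + k + 2 with hA
  have hA11 : 11 ≤ A := by omega
  have hApos : 0 < A := by omega
  have hm : c + k + 1 ≠ 0 := by omega
  have hAc : (L + c) ^ c ≤ A ^ (c + k + 1) :=
    (Nat.pow_le_pow_left (by omega) c).trans (Nat.pow_le_pow_right hApos (by omega))
  have hAk : (L + k) ^ k ≤ A ^ (c + k + 1) :=
    (Nat.pow_le_pow_left (by omega) k).trans (Nat.pow_le_pow_right hApos (by omega))
  have hAL : L ≤ A ^ (c + k + 1) := (show L ≤ A by omega).trans (Nat.le_self_pow hm A)
  have hA1 : 1 ≤ A ^ (c + k + 1) := Nat.one_le_pow _ _ hApos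
  have hexp : 2 * E + 4 + (L + c) ^ c ≤ A ^ (c + k + 2) := by
    calc 2 * E + 4 + (L + c) ^ c = 2 * (L + k) ^ k + 2 * L + 6 + (L + c) ^ c := by rw [hE]; ring
      _ ≤ 2 * A ^ (c + k + 1) + 2 * A ^ (c + k + 1) + 6 * A ^ (c + k + 1) + A ^ (c + k + 1) := by
          have := Nat.mul_le_mul_left 6 hA1; omega
      _ = 11 * A ^ (c + k + 1) := by ring
      _ ≤ A * A ^ (c + k + 1) := Nat.mul_le_mul_right _ hA11
      _ = A ^ (c + k + 2) := by ring
  calc (n + d + 2) ^ 2 * 2 ^ ((L + c) ^ c) ≤ 2 ^ (2 * E + 4) * 2 ^ ((L + c) ^ c) := Nat.mul_le_mul_right _ hsq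
    _ = 2 ^ (2 * E + 4 + (L + c) ^ c) := by rw [← pow_add]
    _ ≤ 2 ^ (A ^ (c + k + 2)) := Nat.pow_le_pow_right (by norm_num) hexp
    _ = 2 ^ ((L + (c + k + 2)) ^ (c + k + 2)) := by rw [hA]; ring

/-- ★ **R2 ⇒ R2ᵒ** (the ORDER form of the rung, from the route item R2 = stmt-27271 BY NAME): the DEGREE hypothesis of
the rung relaxes to an ORDER hypothesis — for every `k, c`, eventually in `n`, `NN_n · h` has
`L₊(NN_n · h) > 2^((log₂ n + c)^c)` for every cofactor `h` having SOME nonzero homogeneous component `h^{(d)}` with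
`d ≤ 2^((log₂ n + k)^k)`, whatever the total degree of `h`.  Apply R2 to `h^{(d)}`, then
`L₊(NN_n · h^{(d)}) = L₊((NN_n·h)^{(n+d)}) ≤ (n+d+2)² · L₊(NN_n·h)` and `(n+d+2)² · T c n ≤ T (c+k+2) n`.
[cite: BurgisserClausenShokrollahi1997, Lemma (21.25)] -/
theorem orderRung_of_rung
    (hR : Summit.ValiantsHypothesis.ValiantsHypothesis.Theses.FifoMatching.NNQuasiPolyLogDegreeCofactorHard) :
    ∀ k c : ℕ, ∃ n₀ : ℕ, ∀ n ≥ n₀, ∀ h : MvPolynomial (Fin (2 * n) × Fin (2 * n)) ℝ≥0, ∀ d : ℕ,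
      homogeneousComponent d h ≠ 0 → d ≤ 2 ^ ((Nat.log 2 n + k) ^ k) →
        2 ^ ((Nat.log 2 n + c) ^ c) < complexity (nestFreeMatchingPoly n ℝ≥0 * h) := by
  intro k c
  obtain ⟨n₀, hn₀⟩ := hR k (c + k + 2)
  refine ⟨max n₀ (2 ^ 9), fun n hn h d hd hdk => ?_⟩
  have hn0 : n₀ ≤ n := le_of_max_le_left hn
  have hn9 : 2 ^ 9 ≤ n := le_of_max_le_right hn
  have hdeg : (homogeneousComponent d h).totalDegree ≤ 2 ^ ((Nat.log 2 n + k) ^ k) :=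
    (homogeneousComponent_isHomogeneous d h).totalDegree_le.trans hdk
  have h1 : 2 ^ ((Nat.log 2 n + (c + k + 2)) ^ (c + k + 2)) <
      complexity (nestFreeMatchingPoly n ℝ≥0 * homogeneousComponent d h) :=
    hn₀ n hn0 (homogeneousComponent d h) hd hdeg
  rw [← homogeneousComponent_nn_mul] at h1
  have h2 := complexity_homogeneousComponent_le_sq_mul (nestFreeMatchingPoly n ℝ≥0 * h) (n + d)
  have h3 := order_bookkeeping k c n d hn9 hdk
  by_contra hlt
  push Not at hlt
  have h4 : (n + d + 2) ^ 2 * complexity (nestFreeMatchingPoly n ℝ≥0 * h) ≤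
      (n + d + 2) ^ 2 * 2 ^ ((Nat.log 2 n + c) ^ c) :=
    Nat.mul_le_mul_left _ hlt
  omega

/-- corollary of R2ᵒ: cofactors with a nonzero CONSTANT TERM, of any degree (`h = 1 + g`, …): for every `c`,
eventually in `n`, `2^((log₂ n + c)^c) < L₊(NN_n · h)` whenever `constantCoeff h ≠ 0`. -/
theorem constantTerm_cofactor_hard
    (hR : Summit.ValiantsHypothesis.ValiantsHypothesis.Theses.FifoMatching.NNQuasiPolyLogDegreeCofactorHard) :
    ∀ c : ℕ, ∃ n₀ : ℕ, ∀ n ≥ n₀, ∀ h : MvPolynomial (Fin (2 * n) × Fin (2 * n)) ℝ≥0,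
      constantCoeff h ≠ 0 → 2 ^ ((Nat.log 2 n + c) ^ c) < complexity (nestFreeMatchingPoly n ℝ≥0 * h) := by
  intro c
  obtain ⟨n₀, hn₀⟩ := orderRung_of_rung hR 0 c
  refine ⟨n₀, fun n hn h hh => hn₀ n hn h 0 ?_ (Nat.zero_le _)⟩
  rw [homogeneousComponent_zero]
  intro h0
  apply hh
  have := congrArg constantCoeff h0
  rw [constantCoeff_C, map_zero] at this
  exact this

/-- ladder sanity, BY NAME: the rung R2 (stmt-27271) implies the CLOSED item 23918 `NNLinearDegreeCofactorHard`
(with `a = 1`: `deg h ≤ n < 2^(log₂ n + 1)`; the `+ L₊(h)` of 23918 is not charged). -/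
theorem linearDegree_of_rung
    (hR : Summit.ValiantsHypothesis.ValiantsHypothesis.Theses.FifoMatching.NNQuasiPolyLogDegreeCofactorHard) :
    Summit.ValiantsHypothesis.ValiantsHypothesis.Theses.FifoMatching.NNLinearDegreeCofactorHard := by
  refine ⟨1, fun c => ?_⟩
  obtain ⟨n₀, hn₀⟩ := hR 1 c
  refine ⟨n₀, fun n hn h hh hdeg => ?_⟩
  have hlt : n < 2 ^ ((Nat.log 2 n + 1) ^ 1) := by
    rw [pow_one]; exact Nat.lt_pow_succ_log_self (by norm_num) n
  exact lt_of_lt_of_le (hn₀ n hn h hh (by omega)) (Nat.le_add_right _ _)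

/-! ## The division-side residual picture: R2ᵒ + N2♯ ⇒ N3 ⇒ `NNDivisionHard` -/

/-- exponent bookkeeping: `(L + (L+c)^c + k)^k ≤ (L + k')^{k'}` with `k' = (c+1)k + c + k + 2`. -/
theorem exponent_bookkeeping (c k L : ℕ) :
    (L + (L + c) ^ c + k) ^ k ≤ (L + ((c + 1) * k + c + k + 2)) ^ ((c + 1) * k + c + k + 2) := by
  set y := L + c + k + 2 with hy
  have hy2 : 2 ≤ y := by omega
  have hyc : 1 ≤ y ^ c := Nat.one_le_pow _ _ (by omega)
  have h1 : (L + c) ^ c ≤ y ^ c := Nat.pow_le_pow_left (by omega) c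
  have h2 : L + k ≤ (L + k) * y ^ c := Nat.le_mul_of_pos_right _ (by omega)
  have hbase : L + (L + c) ^ c + k ≤ y ^ (c + 1) := by
    calc L + (L + c) ^ c + k ≤ y ^ c + (L + k) * y ^ c := by omega
      _ = (1 + (L + k)) * y ^ c := by ring
      _ ≤ y * y ^ c := Nat.mul_le_mul_right _ (by omega)
      _ = y ^ (c + 1) := by ring
  calc (L + (L + c) ^ c + k) ^ k ≤ (y ^ (c + 1)) ^ k := Nat.pow_le_pow_left hbase k
    _ = y ^ ((c + 1) * k) := by rw [← pow_mul]
    _ ≤ y ^ ((c + 1) * k + c + k + 2) := Nat.pow_le_pow_right (by omega) (by omega)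
    _ ≤ (L + ((c + 1) * k + c + k + 2)) ^ ((c + 1) * k + c + k + 2) :=
        Nat.pow_le_pow_left (by omega) _

/-- a nonzero polynomial over `ℝ≥0` has a nonzero homogeneous component of degree `≤` its total degree -/
theorem exists_homogeneousComponent_ne_zero {σ : Type} (p : MvPolynomial σ ℝ≥0) (hp : p ≠ 0) :
    ∃ d ≤ p.totalDegree, homogeneousComponent d p ≠ 0 := by
  classical
  by_contra hall
  push Not at hall
  apply hp
  rw [← sum_homogeneousComponent p]
  exact Finset.sum_eq_zero fun d hd => hall d (Nat.lt_succ_iff.1 (Finset.mem_range.1 hd))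

/-- **N2 ⇒ N2♯** (both unfolded): the ORDER-reduction residual — a cheap multiple can be traded for a cheap multiple
having SOME nonzero homogeneous component of quasi-polynomial degree — is WEAKER than the DEGREE-reduction residual
(a cheap multiple can be traded for a cheap multiple of quasi-polynomial degree). -/
theorem orderReduction_of_reduction
    (hD : ∃ k : ℕ, ∀ (n : ℕ) (h : MvPolynomial (Fin (2 * n) × Fin (2 * n)) ℝ≥0), h ≠ 0 →
      ∃ h' : MvPolynomial (Fin (2 * n) × Fin (2 * n)) ℝ≥0, h' ≠ 0 ∧
        h'.totalDegree ≤
            2 ^ ((Nat.log 2 n + Nat.log 2 (complexity (nestFreeMatchingPoly n ℝ≥0 * h)) + k) ^ k) ∧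
          complexity (nestFreeMatchingPoly n ℝ≥0 * h') ≤
            2 ^ ((Nat.log 2 n + Nat.log 2 (complexity (nestFreeMatchingPoly n ℝ≥0 * h)) + k) ^ k)) :
    ∃ k : ℕ, ∀ (n : ℕ) (h : MvPolynomial (Fin (2 * n) × Fin (2 * n)) ℝ≥0), h ≠ 0 →
      ∃ (h' : MvPolynomial (Fin (2 * n) × Fin (2 * n)) ℝ≥0) (d : ℕ), homogeneousComponent d h' ≠ 0 ∧
        d ≤ 2 ^ ((Nat.log 2 n + Nat.log 2 (complexity (nestFreeMatchingPoly n ℝ≥0 * h)) + k) ^ k) ∧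
          complexity (nestFreeMatchingPoly n ℝ≥0 * h') ≤
            2 ^ ((Nat.log 2 n + Nat.log 2 (complexity (nestFreeMatchingPoly n ℝ≥0 * h)) + k) ^ k) := by
  obtain ⟨k, hk⟩ := hD
  refine ⟨k, fun n h hh => ?_⟩
  obtain ⟨h', hh', hdeg', hcomp'⟩ := hk n h hh
  obtain ⟨d, hd, hne⟩ := exists_homogeneousComponent_ne_zero h' hh'
  exact ⟨h', d, hne, hd.trans hdeg', hcomp'⟩

/-- **R2ᵒ + N2♯ ⇒ N3** (all unfolded; NN twin of the logic of the kernel-checked `DivisionGap.ShadowCofactorSplit`): if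
multiples with a nonzero homogeneous component of quasi-polynomial degree are hard (R2ᵒ) and every cheap multiple
yields a cheap multiple with such a component (N2♯), then ALL nonzero multiples of `NN_n` are hard (N3). -/
theorem multiples_of_orderRung_of_orderReduction
    (hR : ∀ k c : ℕ, ∃ n₀ : ℕ, ∀ n ≥ n₀, ∀ h : MvPolynomial (Fin (2 * n) × Fin (2 * n)) ℝ≥0, ∀ d : ℕ,
      homogeneousComponent d h ≠ 0 → d ≤ 2 ^ ((Nat.log 2 n + k) ^ k) →
        2 ^ ((Nat.log 2 n + c) ^ c) < complexity (nestFreeMatchingPoly n ℝ≥0 * h))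
    (hD : ∃ k : ℕ, ∀ (n : ℕ) (h : MvPolynomial (Fin (2 * n) × Fin (2 * n)) ℝ≥0), h ≠ 0 →
      ∃ (h' : MvPolynomial (Fin (2 * n) × Fin (2 * n)) ℝ≥0) (d : ℕ), homogeneousComponent d h' ≠ 0 ∧
        d ≤ 2 ^ ((Nat.log 2 n + Nat.log 2 (complexity (nestFreeMatchingPoly n ℝ≥0 * h)) + k) ^ k) ∧
          complexity (nestFreeMatchingPoly n ℝ≥0 * h') ≤
            2 ^ ((Nat.log 2 n + Nat.log 2 (complexity (nestFreeMatchingPoly n ℝ≥0 * h)) + k) ^ k)) :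
    ∀ c : ℕ, ∃ n₀ : ℕ, ∀ n ≥ n₀, ∀ h : MvPolynomial (Fin (2 * n) × Fin (2 * n)) ℝ≥0, h ≠ 0 →
      2 ^ ((Nat.log 2 n + c) ^ c) < complexity (nestFreeMatchingPoly n ℝ≥0 * h) := by
  intro c
  obtain ⟨k, hk⟩ := hD
  set k' := (c + 1) * k + c + k + 2 with hk'
  obtain ⟨n₀, hn₀⟩ := hR k' k'
  refine ⟨n₀, fun n hn h hh => ?_⟩
  by_contra hs
  push Not at hs
  have hlog : Nat.log 2 (complexity (nestFreeMatchingPoly n ℝ≥0 * h)) ≤ (Nat.log 2 n + c) ^ c := by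
    calc Nat.log 2 (complexity (nestFreeMatchingPoly n ℝ≥0 * h))
        ≤ Nat.log 2 (2 ^ ((Nat.log 2 n + c) ^ c)) := Nat.log_mono_right hs
      _ = (Nat.log 2 n + c) ^ c := Nat.log_pow (by norm_num) _
  obtain ⟨h', d, hne, hd, hcomp'⟩ := hk n h hh
  have hE : (Nat.log 2 n + Nat.log 2 (complexity (nestFreeMatchingPoly n ℝ≥0 * h)) + k) ^ k ≤
      (Nat.log 2 n + k') ^ k' := by
    calc (Nat.log 2 n + Nat.log 2 (complexity (nestFreeMatchingPoly n ℝ≥0 * h)) + k) ^ k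
        ≤ (Nat.log 2 n + (Nat.log 2 n + c) ^ c + k) ^ k := Nat.pow_le_pow_left (by omega) k
      _ ≤ (Nat.log 2 n + k') ^ k' := exponent_bookkeeping c k (Nat.log 2 n)
  have hpow : 2 ^ ((Nat.log 2 n + Nat.log 2 (complexity (nestFreeMatchingPoly n ℝ≥0 * h)) + k) ^ k) ≤
      2 ^ ((Nat.log 2 n + k') ^ k') :=
    Nat.pow_le_pow_right (by norm_num) hE
  have hlt := hn₀ n hn h' d hne (hd.trans hpow)
  exact absurd (lt_of_lt_of_le hlt (hcomp'.trans hpow)) (lt_irrefl _)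

/-- ★ **THE RESIDUAL PICTURE, BY NAME (order form)**: the rung R2 (route item stmt-27271) together with the ORDER
reduction N2♯ (unfolded: some `k` such that every nonzero `h` admits `h'` and `d` with `h'^{(d)} ≠ 0`,
`d ≤ 2^((log₂ n + log₂ L₊(NN_n·h) + k)^k)` and `L₊(NN_n·h') ≤` the same bound) gives the route's residual item
stmt-21181 `NNDivisionHard` (all nonzero multiples of `NN_n` are quasi-polynomially hard; the `+ L₊(h)` is not
charged).  What N2♯ leaves open = cofactors supported ENTIRELY in super-quasi-polynomial degrees. -/
theorem nnDivisionHard_of_rung_of_orderReduction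
    (hR : Summit.ValiantsHypothesis.ValiantsHypothesis.Theses.FifoMatching.NNQuasiPolyLogDegreeCofactorHard)
    (hD : ∃ k : ℕ, ∀ (n : ℕ) (h : MvPolynomial (Fin (2 * n) × Fin (2 * n)) ℝ≥0), h ≠ 0 →
      ∃ (h' : MvPolynomial (Fin (2 * n) × Fin (2 * n)) ℝ≥0) (d : ℕ), homogeneousComponent d h' ≠ 0 ∧
        d ≤ 2 ^ ((Nat.log 2 n + Nat.log 2 (complexity (nestFreeMatchingPoly n ℝ≥0 * h)) + k) ^ k) ∧
          complexity (nestFreeMatchingPoly n ℝ≥0 * h') ≤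
            2 ^ ((Nat.log 2 n + Nat.log 2 (complexity (nestFreeMatchingPoly n ℝ≥0 * h)) + k) ^ k)) :
    Summit.ValiantsHypothesis.ValiantsHypothesis.Theses.FifoMatching.NNDivisionHard := by
  intro c
  obtain ⟨n₀, hn₀⟩ := multiples_of_orderRung_of_orderReduction (orderRung_of_rung hR) hD c
  exact ⟨n₀, fun n hn h hh => lt_of_lt_of_le (hn₀ n hn h hh) (Nat.le_add_right _ _)⟩

/-- ★ **THE RESIDUAL PICTURE, BY NAME (degree form)**: the rung R2 (route item stmt-27271) together with the DEGREE
reduction N2 (unfolded: some `k` such that every nonzero `h` admits a nonzero `h'` with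
`deg h' ≤ 2^((log₂ n + log₂ L₊(NN_n·h) + k)^k)` and `L₊(NN_n·h') ≤` the same bound) gives the route's residual item
stmt-21181 `NNDivisionHard`. -/
theorem nnDivisionHard_of_rung_of_reduction
    (hR : Summit.ValiantsHypothesis.ValiantsHypothesis.Theses.FifoMatching.NNQuasiPolyLogDegreeCofactorHard)
    (hD : ∃ k : ℕ, ∀ (n : ℕ) (h : MvPolynomial (Fin (2 * n) × Fin (2 * n)) ℝ≥0), h ≠ 0 →
      ∃ h' : MvPolynomial (Fin (2 * n) × Fin (2 * n)) ℝ≥0, h' ≠ 0 ∧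
        h'.totalDegree ≤
            2 ^ ((Nat.log 2 n + Nat.log 2 (complexity (nestFreeMatchingPoly n ℝ≥0 * h)) + k) ^ k) ∧
          complexity (nestFreeMatchingPoly n ℝ≥0 * h') ≤
            2 ^ ((Nat.log 2 n + Nat.log 2 (complexity (nestFreeMatchingPoly n ℝ≥0 * h)) + k) ^ k)) :
    Summit.ValiantsHypothesis.ValiantsHypothesis.Theses.FifoMatching.NNDivisionHard :=
  nnDivisionHard_of_rung_of_orderReduction hR (orderReduction_of_reduction hD)

end NNOrderRung

end Summit.ValiantsHypothesis.ValiantsHypothesis.Theorems.FifoMatching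

end
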